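import Mathlib.Analysis.SpecialFunctions.Trigonometric.Deriv
import Mathlib.Analysis.SpecialFunctions.Trigonometric.Basic
import Mathlib.Analysis.Calculus.Deriv.Mul
import Mathlib.Analysis.Calculus.Deriv.Add
import Mathlib.Analysis.Calculus.Deriv.Comp
import Mathlib.Algebra.BigOperators.Group.Finset.Basic
import Mathlib.Algebra.BigOperators.Ring.Finset
import Mathlib.Tactic.FieldSimp
import Mathlib.Tactic.Ring
import Mathlib.Tactic.Linarith
import HarnessLib

/-!
# Classical (swing-equation) models of power-system transient stability, as printed

Topic `Literature/MathematicalPhysics/PowerSystems` (LADDER-GRIDFUSION rung G3 / G1 inputs; seat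
gridfusion-lit-2).  This file types, VERBATIM FROM THE TEXTBOOKS and with equation numbers, the two
models every transient-stability certificate of the GRIDFUSION ladder is ABOUT, together with the
textbook energy functions and their printed identities — all PROVED here (no named facts):

1. `SMIB` — the single-machine–infinite-bus swing equation
   `M d²δ/dt² = P_m − P_e^max sin δ − D dδ/dt` [SauerPai1998, §9.6.2 eq. (9.30); Example 9.2 for the
   damping term], its transient energy function
   `V(δ,ω) = ½Mω² − P_m(δ − δ^s) − P_e^max(cos δ − cos δ^s)` [SauerPai1998, (9.33)–(9.35)], the
   critical energy `V_cr = V_PE(δ^u) = −P_m(π − 2δ^s) + 2P_e^max cos δ^s` at the unstable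
   equilibrium `δ^u = π − δ^s` [SauerPai1998, (9.47)] (= the equal-area criterion, §9.6.3), and the
   orbital-derivative identity `dV/dt = −D ω²` (so `V` is a first integral when `D = 0`,
   [SauerPai1998, (9.32)]).  The printed Example 9.2–9.4 (`0.2 δ̈ = 1 − 2 sin δ − 0.02 δ̇`,
   `δ^s = π/6`) is included as the textbook's own instance, with its equilibrium and `V_cr` checked.
2. `InternalNode` — the classical network-reduced `m`-machine model («internal-node model»,
   constant voltage `E_i` behind transient reactance, loads as constant impedances, network
   Kron-reduced to the internal nodes with reduced admittance `G_ij + jB_ij`):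
   `P_ei = Σ_j E_iE_j(G_ij cos δ_ij + B_ij sin δ_ij) = E_i²G_ii + Σ_{j≠i}(C_ij sin δ_ij + D_ij cos δ_ij)`,
   `C_ij = E_iE_jB_ij`, `D_ij = E_iE_jG_ij` [SauerPai1998, (7.212)–(7.214); AndersonFouad1977,
   (2.55)], the swing equations `dδ_i/dt = ω_i − ω_s`,
   `dω_i/dt = (1/M_i)(P_mi − P_ei − D_i(ω_i − ω_s))`, `M_i = 2H_i/ω_s` [SauerPai1998, (9.13)–(9.18),
   (7.215)–(7.216); AndersonFouad1977, (2.56)], the injected powers `P_i = P_mi − E_i²G_ii`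
   [SauerPai1998, (9.15)], the centre of inertia [SauerPai1998, (9.19)], and the classical energy
   function WITHOUT transfer conductances
   `W = ½ Σ M_i(ω_i − ω_s)² − Σ P_i(δ_i − δ_i^s) − Σ_{i<j} C_ij(cos δ_ij − cos δ_ij^s)`
   [SauerPai1998, (9.28) with the path-dependent `D_ij`-term absent], with the PROVED identity
   `dW/dt = −Σ D_i(ω_i − ω_s)²` along solutions when the transfer conductances vanish
   (`G_ij = 0`, `i ≠ j`) — the statement behind «if `D_ij ≡ 0`, it can be shown that `V`
   constitutes a proper Lyapunov function» [SauerPai1998, text after (9.29)] and behind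
   [SauerPai1998, (9.59)].

## Three columns (LADDER-GRIDFUSION honest framing)
Everything here is MODELLED: these are the printed MODELS and their algebraic/calculus identities.
Nothing in this file says that any grid is stable; the word is reserved for «model M, perturbation
class C, kernel certificate».  What each model leaves out (AVR/governor, saliency, flux decay, load
dynamics, network structure, transfer-conductance path dependence) is the business of the cell's
MODEL-VALIDITY register, not of this file.

## What is NOT here
* No benchmark DATA beyond the one printed SMIB example (the WSCC 3-machine/9-bus and NE 39-bus
  numbers live in the cell's data files with their table locators; see lit/2-REGISTER.md).
* No polynomialisation (`s = sin δ`, `c = cos δ`) and no region-of-attraction statement: those are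
  the Summits-side typed models and certificates (Ventures/GridStability).
* No structure-preserving (Bergen–Hill) model — separate file.
* The path-dependent transfer-conductance term of [SauerPai1998, (9.28)] is deliberately not typed:
  with it `V` is not a function of state (ibid.), which is exactly why certificates are sought by
  other means.
-/

noncomputable section

namespace Literature.MathematicalPhysics.PowerSystems

open Real Finset
open scoped BigOperators

/-! ## 1. Single machine – infinite bus (SMIB) -/

/-- Parameters of the classical single-machine–infinite-bus swing equation
`M d²δ/dt² = P_m − P_e^max sin δ − D dδ/dt`: inertia coefficient `M` (`= 2H/ω_s`), damping
coefficient `D`, mechanical input `P_m`, and `P_e^max = E₁E₂/X` of the network in force (pre-fault,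
faulted or post-fault — each is a different `SMIB` value).  MODELLED: classical machine (constant voltage
behind transient reactance), lossless reduced network (`P_e = P_e^max sin δ`, no `P_C`, no `γ`:
[AndersonFouad1977, §2.7, discussion of Fig. 2.9]).
[cite: SauerPai1998, §9.6.2 eq. (9.30) and Example 9.2] -/
structure SMIB where
  /-- inertia coefficient `M = 2H/ω_s` (coefficient of `d²δ/dt²`) -/
  M : ℝ
  /-- damping coefficient `D` (coefficient of `dδ/dt`; `0` in (9.30), `0.02` in Example 9.2) -/
  D : ℝ
  /-- mechanical power input `P_m` -/
  Pm : ℝ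
  /-- maximum electrical power `P_e^max = E₁E₂/X` of the reduced two-node network -/
  Pmax : ℝ

namespace SMIB

variable (p : SMIB)

/-- Electrical power output `P_e(δ) = P_e^max sin δ` of the machine at rotor angle `δ` (relative to
the infinite bus). [cite: SauerPai1998, §9.6.1–§9.6.2, eq. (9.30)] -/
def electricalPower (δ : ℝ) : ℝ := p.Pmax * Real.sin δ

/-- Rotor acceleration: the swing equation `M δ̈ = P_m − P_e^max sin δ − D δ̇` solved for `δ̈`, as a
function of the state `(δ, ω)` with `ω = δ̇` the rotor speed relative to synchronous speed.
[cite: SauerPai1998, §9.6.2 eq. (9.30); Example 9.2 (damped form)] -/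
def accel (δ ω : ℝ) : ℝ := (p.Pm - p.Pmax * Real.sin δ - p.D * ω) / p.M

/-- The swing vector field on the phase plane: `(δ, ω) ↦ (ω, accel δ ω)`.
[cite: SauerPai1998, §9.6.2 eq. (9.30) with `dδ/dt = ω`] -/
def vectorField (x : ℝ × ℝ) : ℝ × ℝ := (x.2, p.accel x.1 x.2)

/-- `δs` is an equilibrium angle: `0 = P_m − P_e^max sin δs` (the s.e.p. `δ^s = sin⁻¹(P_m/P_e^max)`
and the u.e.p.s `π − δ^s`, `−π − δ^s` all satisfy it). [cite: SauerPai1998, §9.6.2, text after (9.33)] -/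
def IsEquilibriumAngle (δs : ℝ) : Prop := p.Pm = p.Pmax * Real.sin δs

/-- Potential energy with datum at `δs`:
`V_PE(δ, δ^s) = −P_m(δ − δ^s) − P_e^max(cos δ − cos δ^s)`. [cite: SauerPai1998, §9.6.2 eq. (9.34)] -/
def potentialEnergy (δs δ : ℝ) : ℝ := -p.Pm * (δ - δs) - p.Pmax * (Real.cos δ - Real.cos δs)

/-- Transient energy function `V(δ, ω) = ½Mω² + V_PE(δ, δ^s) = V_KE + V_PE`.
[cite: SauerPai1998, §9.6.2 eq. (9.35)] -/
def energy (δs : ℝ) (x : ℝ × ℝ) : ℝ := 1 / 2 * p.M * x.2 ^ 2 + p.potentialEnergy δs x.1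

/-- Critical energy `V_cr = V_PE(δ^u) = −P_m(π − 2δ^s) + 2P_e^max cos δ^s`, the potential energy at
the unstable equilibrium `δ^u = π − δ^s`; `V(δ,ω) < V_cr` on the fault-on trajectory is the equal-area
criterion `A₁ < A₂`. [cite: SauerPai1998, §9.6.3 eqs. (9.46)–(9.48)] -/
def criticalEnergy (δs : ℝ) : ℝ := -p.Pm * (π - 2 * δs) + 2 * p.Pmax * Real.cos δs

/-- `V_PE` vanishes at its datum. [cite: SauerPai1998, §9.6.2, text before (9.36)] -/
theorem potentialEnergy_self (δs : ℝ) : p.potentialEnergy δs δs = 0 := by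
  simp [potentialEnergy]

/-- `V(δ^s, 0) = 0`: «at the postfault s.e.p. both `V_KE` and `V_PE` are zero».
[cite: SauerPai1998, §9.6.2, text before (9.36)] -/
theorem energy_sep (δs : ℝ) : p.energy δs (δs, 0) = 0 := by
  simp [energy, potentialEnergy]

/-- `V` evaluated at the unstable equilibrium `(π − δ^s, 0)` equals the critical energy `V_cr`.
[cite: SauerPai1998, §9.6.3 eq. (9.47)] -/
theorem energy_uep (δs : ℝ) : p.energy δs (π - δs, 0) = p.criticalEnergy δs := by
  simp only [energy, potentialEnergy, criticalEnergy, Real.cos_pi_sub]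
  ring

/-- At an equilibrium angle the acceleration vanishes for `ω = 0`. [cite: SauerPai1998, §9.6.2] -/
theorem accel_eq_zero_of_isEquilibriumAngle {δs : ℝ} (h : p.IsEquilibriumAngle δs) :
    p.accel δs 0 = 0 := by
  unfold IsEquilibriumAngle at h
  simp [accel, h]

/-- The equilibria `(δs, 0)` are zeros of the swing vector field. [cite: SauerPai1998, §9.6.2] -/
theorem vectorField_eq_zero_of_isEquilibriumAngle {δs : ℝ} (h : p.IsEquilibriumAngle δs) :
    p.vectorField (δs, 0) = 0 := by
  simp [vectorField, p.accel_eq_zero_of_isEquilibriumAngle h, Prod.ext_iff]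

/-- If `δs` is an equilibrium angle then so is `π − δs` (the u.e.p. `δ^u`).
[cite: SauerPai1998, §9.6.2, text after (9.35)] -/
theorem isEquilibriumAngle_pi_sub {δs : ℝ} (h : p.IsEquilibriumAngle δs) :
    p.IsEquilibriumAngle (π - δs) := by
  unfold IsEquilibriumAngle at *
  simpa [Real.sin_pi_sub] using h

/-- `dV_PE/dδ = −P_m + P_e^max sin δ` (so `M δ̈ = −∂V_PE/∂δ`, [SauerPai1998, (9.37)]).
[cite: SauerPai1998, §9.6.2 eqs. (9.31), (9.37)] -/
theorem hasDerivAt_potentialEnergy (δs δ : ℝ) :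
    HasDerivAt (p.potentialEnergy δs) (-p.Pm + p.Pmax * Real.sin δ) δ := by
  have h1 : HasDerivAt (fun x : ℝ => -p.Pm * (x - δs)) (-p.Pm * 1) δ :=
    ((hasDerivAt_id δ).sub_const δs).const_mul (-p.Pm)
  have h2 : HasDerivAt (fun x : ℝ => p.Pmax * (Real.cos x - Real.cos δs)) (p.Pmax * -Real.sin δ) δ :=
    ((Real.hasDerivAt_cos δ).sub_const (Real.cos δs)).const_mul p.Pmax
  unfold potentialEnergy
  refine (h1.fun_sub h2).congr_deriv ?_
  ring

/-- ORBITAL DERIVATIVE of the energy function: along any solution `(δ(t), ω(t))` of the damped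
swing equation (`δ̇ = ω`, `ω̇ = accel δ ω`), `d/dt V(δ(t), ω(t)) = −D ω(t)²`.  For `D = 0` this is
(9.32) («the system is conservative»); with damping it is the standard computation behind
«since there is always some positive damping, we may call it stable» (ibid., after (9.39)).
Requires `M ≠ 0`. [cite: SauerPai1998, §9.6.2 eq. (9.32)] -/
theorem hasDerivAt_energy (hM : p.M ≠ 0) (δs : ℝ) {δ ω : ℝ → ℝ} {t : ℝ}
    (hδ : HasDerivAt δ (ω t) t) (hω : HasDerivAt ω (p.accel (δ t) (ω t)) t) :
    HasDerivAt (fun s => p.energy δs (δ s, ω s)) (-(p.D * ω t ^ 2)) t := by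
  have hV : HasDerivAt (fun s => p.potentialEnergy δs (δ s))
      ((-p.Pm + p.Pmax * Real.sin (δ t)) * ω t) t :=
    (p.hasDerivAt_potentialEnergy δs (δ t)).comp t hδ
  have hK : HasDerivAt (fun s => 1 / 2 * p.M * ω s ^ 2)
      (1 / 2 * p.M * (p.accel (δ t) (ω t) * ω t + ω t * p.accel (δ t) (ω t))) t := by
    have h := (hω.fun_mul hω).const_mul (1 / 2 * p.M)
    simpa only [sq] using h
  refine (hK.fun_add hV).congr_deriv ?_
  simp only [accel]
  field_simp
  ring

/-- With zero damping the energy is a first integral: `dV/dt = 0` along solutions.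
[cite: SauerPai1998, §9.6.2 eq. (9.32)] -/
theorem hasDerivAt_energy_of_undamped (hM : p.M ≠ 0) (hD : p.D = 0) (δs : ℝ) {δ ω : ℝ → ℝ}
    {t : ℝ} (hδ : HasDerivAt δ (ω t) t) (hω : HasDerivAt ω (p.accel (δ t) (ω t)) t) :
    HasDerivAt (fun s => p.energy δs (δ s, ω s)) 0 t := by
  simpa [hD] using p.hasDerivAt_energy hM δs hδ hω

/-! ### The printed example [SauerPai1998, Examples 9.2–9.4] -/

/-- Sauer–Pai Example 9.2: the POST-FAULT SMIB system `0.2 d²δ/dt² = 1 − 2 sin δ − 0.02 dδ/dt`,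
i.e. `M = 0.2`, `D = 0.02`, `P_m = 1`, `P_e^max = 2`. [cite: SauerPai1998, §9.6.2 Example 9.2] -/
def sauerPaiEx92 : SMIB where
  M := 0.2
  D := 0.02
  Pm := 1
  Pmax := 2

/-- Sauer–Pai Example 9.4: the FAULTED system of the same example,
`0.2 d²δ/dt² = 1 − sin δ − 0.02 dδ/dt` (`P_e^max = 1` during the fault).
[cite: SauerPai1998, §9.6.3 Example 9.4] -/
def sauerPaiEx94Faulted : SMIB where
  M := 0.2
  D := 0.02
  Pm := 1
  Pmax := 1

/-- «`δ^s = sin⁻¹(1/2)`. Hence `δ^s = π/6`» — the printed stable equilibrium angle of Example 9.2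
is an equilibrium angle. [cite: SauerPai1998, §9.6.2 Example 9.2] -/
theorem sauerPaiEx92_isEquilibriumAngle : sauerPaiEx92.IsEquilibriumAngle (π / 6) := by
  simp only [IsEquilibriumAngle, sauerPaiEx92, Real.sin_pi_div_six]
  norm_num

/-- «`δ^u = π − π/6 = 5π/6`» is an equilibrium angle too. [cite: SauerPai1998, §9.6.2 Example 9.2] -/
theorem sauerPaiEx92_isEquilibriumAngle_uep : sauerPaiEx92.IsEquilibriumAngle (5 * π / 6) := by
  have h := sauerPaiEx92.isEquilibriumAngle_pi_sub sauerPaiEx92_isEquilibriumAngle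
  convert h using 2
  ring

/-- The critical energy of Example 9.4 in closed form: `V_cr = V(δ^u, 0) = −(π − 2π/6) + 4 cos(π/6)
= 2√3 − 2π/3` (the book evaluates this numerically as `−2.09 + 3.464 = 1.374`; the exact value is
`2√3 − 2π/3 ≈ 1.3697`). [cite: SauerPai1998, §9.6.3 Example 9.4] -/
theorem sauerPaiEx92_criticalEnergy :
    sauerPaiEx92.criticalEnergy (π / 6) = 2 * Real.sqrt 3 - 2 * π / 3 := by
  simp only [criticalEnergy, sauerPaiEx92, Real.cos_pi_div_six]
  ring

end SMIB

/-! ## 2. Classical network-reduced multimachine model (internal-node model) -/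

/-- Data of the classical network-reduced `m`-machine model: inertia constants `H_i` (s), damping
coefficients `D_i`, mechanical inputs `P_mi` (= `T_Mi` in pu), internal voltage magnitudes `E_i`
(constant, behind `x'_d`), the REAL and IMAGINARY parts `G_ij`, `B_ij` of the admittance matrix
REDUCED TO THE INTERNAL NODES for the network condition in force (pre-fault / faulted / post-fault
are different `InternalNode` values), and synchronous speed `ω_s` (rad/s).  MODELLED: classical machines, loads as
constant impedances, Kron reduction [SauerPai1998, §7.9.3 (7.205)–(7.209); AndersonFouad1977,
§2.10.2 steps 1–5 and (2.63)–(2.65)].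
[cite: SauerPai1998, §7.9.3 eqs. (7.209)–(7.216) and §9.4 eqs. (9.13)–(9.18)] -/
structure InternalNode (m : ℕ) where
  /-- inertia constants `H_i` -/
  H : Fin m → ℝ
  /-- damping coefficients `D_i` (coefficient of `dδ_i/dt` in (9.13)) -/
  D : Fin m → ℝ
  /-- mechanical power inputs `P_mi` -/
  Pm : Fin m → ℝ
  /-- internal voltage magnitudes `E_i` -/
  E : Fin m → ℝ
  /-- reduced conductance matrix `G_ij` (internal nodes) -/
  G : Fin m → Fin m → ℝ
  /-- reduced susceptance matrix `B_ij` (internal nodes) -/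
  B : Fin m → Fin m → ℝ
  /-- synchronous speed `ω_s` -/
  ωs : ℝ

namespace InternalNode

variable {m : ℕ} (d : InternalNode m)

/-- `M_i ≜ 2H_i/ω_s`. [cite: SauerPai1998, §9.4, definition before (9.15); Example 7.1] -/
def M (i : Fin m) : ℝ := 2 * d.H i / d.ωs

/-- `C_ij = E_iE_jB_ij`. [cite: SauerPai1998, §7.9.3 eq. (7.213)] -/
def C (i j : Fin m) : ℝ := d.E i * d.E j * d.B i j

/-- `D_ij = E_iE_jG_ij` (the transfer-conductance coefficients). [cite: SauerPai1998, §7.9.3 eq. (7.214)] -/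
def Dtr (i j : Fin m) : ℝ := d.E i * d.E j * d.G i j

/-- Electrical power out of internal node `i`:
`P_ei = Σ_{j=1}^{m} E_iE_j(G_ij cos δ_ij + B_ij sin δ_ij)`, `δ_ij = δ_i − δ_j`.
[cite: SauerPai1998, §7.9.3 eq. (7.212), first line; AndersonFouad1977, §2.9 eq. (2.55)] -/
def electricalPower (δ : Fin m → ℝ) (i : Fin m) : ℝ :=
  ∑ j, d.E i * d.E j * (d.G i j * Real.cos (δ i - δ j) + d.B i j * Real.sin (δ i - δ j))

/-- Injected power `P_i ≜ P_mi − E_i²G_ii`. [cite: SauerPai1998, §9.4, definition before (9.15)] -/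
def Pinj (i : Fin m) : ℝ := d.Pm i - d.E i ^ 2 * d.G i i

/-- The second printed form of `P_ei`:
`P_ei = E_i²G_ii + Σ_{j≠i}(C_ij sin δ_ij + D_ij cos δ_ij)`.
[cite: SauerPai1998, §7.9.3 eq. (7.212), second line, and §9.4 eq. (9.14); AndersonFouad1977, §2.9 eq. (2.55)] -/
theorem electricalPower_eq (δ : Fin m → ℝ) (i : Fin m) :
    d.electricalPower δ i =
      d.E i ^ 2 * d.G i i + ∑ j ∈ univ.erase i, (d.C i j * Real.sin (δ i - δ j)
        + d.Dtr i j * Real.cos (δ i - δ j)) := by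
  unfold electricalPower C Dtr
  rw [← Finset.add_sum_erase (s := univ) (a := i) _ (mem_univ i)]
  congr 1
  · simp [sq]
  · refine Finset.sum_congr rfl fun j _ => ?_
    ring

/-- Swing equations of the internal-node model, first-order form:
`dδ_i/dt = ω_i − ω_s`, `dω_i/dt = (1/M_i)(P_mi − P_ei(δ) − D_i(ω_i − ω_s))`
(equivalently (9.18) with `P_i − P_ei` in the notation of (9.16), by `electricalPower_eq`).  This is
the right-hand side for `ω_i`. [cite: SauerPai1998, §9.4 eqs. (9.13), (9.17)–(9.18); §7.9.3 eqs. (7.215)–(7.216); AndersonFouad1977, §2.9 eq. (2.56)] -/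
def accel (δ ω : Fin m → ℝ) (i : Fin m) : ℝ :=
  (d.Pm i - d.electricalPower δ i - d.D i * (ω i - d.ωs)) / d.M i

/-- `(δ, ω) : ℝ → (Fin m → ℝ)²` solves the internal-node swing equations at time `t`.
[cite: SauerPai1998, §9.4 eqs. (9.17)–(9.18)] -/
def IsSolutionAt (δ ω : ℝ → Fin m → ℝ) (t : ℝ) : Prop :=
  ∀ i, HasDerivAt (fun s => δ s i) (ω t i - d.ωs) t ∧
    HasDerivAt (fun s => ω s i) (d.accel (δ t) (ω t) i) t

/-- `δs` is an equilibrium angle vector (all machines at synchronous speed): `P_mi = P_ei(δs)` for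
every `i` — the s.e.p./u.e.p. equations `f_i = 0` of (9.23) in absolute angles.
[cite: SauerPai1998, §9.5 eq. (9.23); AndersonFouad1977, §2.9 eq. (2.57)] -/
def IsEquilibrium (δs : Fin m → ℝ) : Prop := ∀ i, d.Pm i = d.electricalPower δs i

/-- Centre of inertia (centre of angle) `δ_o = (1/M_T) Σ M_iδ_i`, `M_T = Σ M_i`.
[cite: SauerPai1998, §9.5 eq. (9.19)] -/
def coi (δ : Fin m → ℝ) : ℝ := (∑ i, d.M i * δ i) / ∑ i, d.M i

/-- COI-referenced angles `θ_i = δ_i − δ_o`. [cite: SauerPai1998, §9.5, text after (9.19)] -/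
def coiAngle (δ : Fin m → ℝ) (i : Fin m) : ℝ := δ i - d.coi δ

/-- The COI angles have zero inertia-weighted sum: `Σ M_iθ_i = 0` (used at (9.24)), provided
`M_T ≠ 0`. [cite: SauerPai1998, §9.5, text before (9.24)] -/
theorem sum_M_mul_coiAngle (δ : Fin m → ℝ) (hMT : ∑ i, d.M i ≠ 0) :
    ∑ i, d.M i * d.coiAngle δ i = 0 := by
  simp only [coiAngle, mul_sub, Finset.sum_sub_distrib, coi]
  rw [← Finset.sum_mul, mul_div_cancel₀ _ hMT, sub_self]

/-- The classical energy function of the internal-node model WITHOUT the transfer-conductance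
(path-dependent) term, in absolute angles with datum at an angle vector `δs`:
`W(δ, ω) = ½ Σ_i M_i(ω_i − ω_s)² − Σ_i P_i(δ_i − δ_i^s) − ½ Σ_i Σ_j C_ij(cos δ_ij − cos δ_ij^s)`.
The double sum over ordered pairs with the factor `½` equals the printed `Σ_{i<j}` for symmetric
`C` (the diagonal terms vanish identically). [cite: SauerPai1998, §9.5 eqs. (9.27)–(9.29) (TEF; the `∫D_ij cos θ_ij d(θ_i+θ_j)` term omitted), §9.6.2 (9.35) for `m = 1`] -/
def energy (δs δ ω : Fin m → ℝ) : ℝ :=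
  ∑ i, 1 / 2 * d.M i * (ω i - d.ωs) ^ 2 - ∑ i, d.Pinj i * (δ i - δs i)
    - 1 / 2 * ∑ i, ∑ j, d.C i j * (Real.cos (δ i - δ j) - Real.cos (δs i - δs j))

/-- With ZERO TRANSFER CONDUCTANCES (`G_ij = 0` for `i ≠ j`) the electrical power reduces to
`P_ei = E_i²G_ii + Σ_j C_ij sin δ_ij`. [cite: SauerPai1998, §9.4 eq. (9.14) with `D_ij = 0`] -/
theorem electricalPower_of_transferConductance_eq_zero
    (hG : ∀ i j, i ≠ j → d.G i j = 0) (δ : Fin m → ℝ) (i : Fin m) :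
    d.electricalPower δ i = d.E i ^ 2 * d.G i i + ∑ j, d.C i j * Real.sin (δ i - δ j) := by
  unfold electricalPower C
  have hsplit : ∀ j, d.E i * d.E j * (d.G i j * Real.cos (δ i - δ j) + d.B i j * Real.sin (δ i - δ j))
      = d.E i * d.E j * d.G i j * Real.cos (δ i - δ j)
        + d.E i * d.E j * d.B i j * Real.sin (δ i - δ j) := fun j => by ring
  simp only [hsplit, Finset.sum_add_distrib]
  congr 1
  rw [Finset.sum_eq_single i]
  · simp [sq]
  · intro j _ hji
    simp [hG i j (Ne.symm hji)]
  · intro hi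
    exact absurd (mem_univ i) hi

/-- Antisymmetry bookkeeping: for symmetric `C`,
`Σ_i Σ_j C_ij sin(δ_i − δ_j) u_j = − Σ_i Σ_j C_ij sin(δ_i − δ_j) u_i` (private helper). [folklore] -/
private theorem sum_sum_C_sin_mul_swap (hB : ∀ i j, d.B i j = d.B j i) (δ u : Fin m → ℝ) :
    ∑ i, ∑ j, d.C i j * Real.sin (δ i - δ j) * u j
      = -∑ i, ∑ j, d.C i j * Real.sin (δ i - δ j) * u i := by
  rw [Finset.sum_comm]
  simp only [← Finset.sum_neg_distrib]
  refine Finset.sum_congr rfl fun i _ => Finset.sum_congr rfl fun j _ => ?_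
  have hC : d.C j i = d.C i j := by unfold C; rw [hB j i]; ring
  rw [hC, ← neg_sub (δ i) (δ j), Real.sin_neg]
  ring

/-- The algebraic identity behind `dW/dt = −Σ D_i(ω_i−ω_s)²`: the raw chain-rule derivative of `W`
along the internal-node field, with `u_i = ω_i − ω_s`, collapses when `B` is symmetric and the
transfer conductances vanish (private helper). [folklore] -/
private theorem energy_deriv_identity (hB : ∀ i j, d.B i j = d.B j i)
    (hG : ∀ i j, i ≠ j → d.G i j = 0) (hM : ∀ i, d.M i ≠ 0) (δ u : Fin m → ℝ) :
    (∑ i, 1 / 2 * d.M i *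
        ((d.Pm i - d.electricalPower δ i - d.D i * u i) / d.M i * u i
          + u i * ((d.Pm i - d.electricalPower δ i - d.D i * u i) / d.M i)))
      - (∑ i, d.Pinj i * u i)
      - 1 / 2 * ∑ i, ∑ j, d.C i j * (-Real.sin (δ i - δ j) * (u i - u j))
    = -∑ i, d.D i * u i ^ 2 := by
  -- kinetic term: ½ M_i (a u + u a) = u (P_mi − P_ei − D_i u)
  have hK : ∀ i, 1 / 2 * d.M i *
        ((d.Pm i - d.electricalPower δ i - d.D i * u i) / d.M i * u i
          + u i * ((d.Pm i - d.electricalPower δ i - d.D i * u i) / d.M i))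
      = u i * (d.Pinj i - ∑ j, d.C i j * Real.sin (δ i - δ j)) - d.D i * u i ^ 2 := by
    intro i
    rw [d.electricalPower_of_transferConductance_eq_zero hG δ i]
    unfold Pinj
    field_simp [hM i]
    ring
  -- coupling term: −½ ΣΣ C (−sin)(u_i − u_j) = ΣΣ C sin u_i
  have hC : -(1 / 2 * ∑ i, ∑ j, d.C i j * (-Real.sin (δ i - δ j) * (u i - u j)))
      = ∑ i, ∑ j, d.C i j * Real.sin (δ i - δ j) * u i := by
    have hsw := d.sum_sum_C_sin_mul_swap hB δ u
    have hexp : ∑ i, ∑ j, d.C i j * (-Real.sin (δ i - δ j) * (u i - u j))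
        = -(∑ i, ∑ j, d.C i j * Real.sin (δ i - δ j) * u i)
          + ∑ i, ∑ j, d.C i j * Real.sin (δ i - δ j) * u j := by
      rw [← Finset.sum_neg_distrib, ← Finset.sum_add_distrib]
      refine Finset.sum_congr rfl fun i _ => ?_
      rw [← Finset.sum_neg_distrib, ← Finset.sum_add_distrib]
      refine Finset.sum_congr rfl fun j _ => ?_
      ring
    rw [hexp, hsw]
    ring
  rw [Finset.sum_congr rfl fun i _ => hK i, Finset.sum_sub_distrib]
  have hA : ∑ i, u i * (d.Pinj i - ∑ j, d.C i j * Real.sin (δ i - δ j))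
      = ∑ i, d.Pinj i * u i - ∑ i, ∑ j, d.C i j * Real.sin (δ i - δ j) * u i := by
    rw [← Finset.sum_sub_distrib]
    refine Finset.sum_congr rfl fun i _ => ?_
    rw [← Finset.sum_mul]
    ring
  linarith [hA, hC]

/-- LYAPUNOV IDENTITY for the classical model without transfer conductances: along any solution of
the internal-node swing equations (9.17)–(9.18) with symmetric `B` and `G_ij = 0 (i ≠ j)`,
`d/dt W(δ(t), ω(t)) = −Σ_i D_i(ω_i(t) − ω_s)²` (≤ 0 for `D_i ≥ 0`; = 0 for the undamped model,
which is (9.59)).  This is the content of «if `D_ij ≡ 0`, it can be shown that `V(θ, ω̃)`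
constitutes a proper Lyapunov function» as far as the derivative is concerned.
[cite: SauerPai1998, §9.5, text after eq. (9.29), and §9.7 eq. (9.59)] -/
theorem hasDerivAt_energy (hB : ∀ i j, d.B i j = d.B j i) (hG : ∀ i j, i ≠ j → d.G i j = 0)
    (hM : ∀ i, d.M i ≠ 0) (δs : Fin m → ℝ) {δ ω : ℝ → Fin m → ℝ} {t : ℝ}
    (hsol : d.IsSolutionAt δ ω t) :
    HasDerivAt (fun s => d.energy δs (δ s) (ω s)) (-∑ i, d.D i * (ω t i - d.ωs) ^ 2) t := by
  have hδ : ∀ i, HasDerivAt (fun s => δ s i) (ω t i - d.ωs) t := fun i => (hsol i).1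
  have hω : ∀ i, HasDerivAt (fun s => ω s i) (d.accel (δ t) (ω t) i) t := fun i => (hsol i).2
  -- kinetic energy
  have hK : HasDerivAt (fun s => ∑ i, 1 / 2 * d.M i * (ω s i - d.ωs) ^ 2)
      (∑ i, 1 / 2 * d.M i * (d.accel (δ t) (ω t) i * (ω t i - d.ωs)
        + (ω t i - d.ωs) * d.accel (δ t) (ω t) i)) t := by
    refine HasDerivAt.fun_sum fun i _ => ?_
    have hu : HasDerivAt (fun s => ω s i - d.ωs) (d.accel (δ t) (ω t) i) t := (hω i).sub_const _
    have h := (hu.fun_mul hu).const_mul (1 / 2 * d.M i)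
    simpa only [sq] using h
  -- position term
  have hP : HasDerivAt (fun s => ∑ i, d.Pinj i * (δ s i - δs i))
      (∑ i, d.Pinj i * (ω t i - d.ωs)) t := by
    refine HasDerivAt.fun_sum fun i _ => ?_
    exact ((hδ i).sub_const _).const_mul _
  -- coupling term
  have hC : HasDerivAt
      (fun s => ∑ i, ∑ j, d.C i j * (Real.cos (δ s i - δ s j) - Real.cos (δs i - δs j)))
      (∑ i, ∑ j, d.C i j * (-Real.sin (δ t i - δ t j) * ((ω t i - d.ωs) - (ω t j - d.ωs)))) t := by
    refine HasDerivAt.fun_sum fun i _ => HasDerivAt.fun_sum fun j _ => ?_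
    exact ((((hδ i).fun_sub (hδ j)).cos).sub_const _).const_mul _
  have hW := (hK.fun_sub hP).fun_sub (hC.const_mul (1 / 2))
  refine hW.congr_deriv ?_
  have key := d.energy_deriv_identity hB hG hM (δ t) (fun i => ω t i - d.ωs)
  simpa only [accel] using key

/-- Undamped case (`D_i = 0`): `W` is a first integral, `dW/dt = 0` — eq. (9.59).
[cite: SauerPai1998, §9.7 eq. (9.59)] -/
theorem hasDerivAt_energy_of_undamped (hB : ∀ i j, d.B i j = d.B j i)
    (hG : ∀ i j, i ≠ j → d.G i j = 0) (hM : ∀ i, d.M i ≠ 0) (hD : ∀ i, d.D i = 0)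
    (δs : Fin m → ℝ) {δ ω : ℝ → Fin m → ℝ} {t : ℝ} (hsol : d.IsSolutionAt δ ω t) :
    HasDerivAt (fun s => d.energy δs (δ s) (ω s)) 0 t := by
  simpa [hD] using d.hasDerivAt_energy hB hG hM δs hsol

end InternalNode

end Literature.MathematicalPhysics.PowerSystems

end
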